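import Mathlib
import HarnessLib
import Literature.Combinatorics.Additive.StevensDeZeeuwIncidence

/-!
# Many point–line incidences: the `k × 4k²` grid (Matoušek, Proposition 4.2.1)

J. Matoušek, *Lectures on Discrete Geometry* (GTM 212, Springer 2002) [Matousek2002], Chapter 4
"Incidence Problems", §4.2 "Lower Bounds: Incidences and Unit Distances", **Proposition 4.2.1**
(Many point–line incidences, pp. 51–52): `I(n,n) = Ω(n^{4/3})`, so the Szemerédi–Trotter upper
bound is asymptotically optimal.

Printed proof (Erdős' construction). Let `n = 4k³`. Take the `k × 4k²` grid
`P = {(i, j) : i = 0, …, k−1, j = 0, …, 4k²−1}` and the `n` lines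
`L = {y = a x + b : a = 0, …, 2k−1, b = 0, …, 2k²−1}`. For `x ∈ [0, k)` one has
`a x + b < a k + b < 2k² + 2k² = 4k²`, so for each `i < k` each line of `L` contains a point of `P`
with abscissa `i`, whence `I(P, L) ≥ k·|L| = ¼ n^{4/3}`.

Setting: a field `F` of characteristic `0` (so that the integer grid embeds), points `P ⊆ F²`,
lines coded as in the tree's `Literature.Combinatorics.Additive.LineIncident` (`inl (a, b)` is
`y = a x + b`, `inr c` is `x = c`), incidences `I(P, L) = #{(p, ℓ) ∈ P × L : p ∈ ℓ}` — the
vocabulary of the companion upper bound `PointLineIncidencesElementary.lean` (Lemma 4.5.1).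

PROVED here (theorems only, no definitions, no named facts):
* `card_grid`, `card_lines` — `|P| = |L| = 4k³`;
* **`grid_incidences`** — `k·|L| = 4k⁴ ≤ I(P, L)` for the grid and the lines above;
* **`many_incidences`** — Proposition 4.2.1: for every `k` there are `n = 4k³` points and `n` lines
  with at least `k·n = 4k⁴` incidences;
* `many_incidences_pow` — the exponent bookkeeping `n⁴ ≤ 4·I³` (i.e. `I ≥ 4^{−1/3} n^{4/3}`);
* `many_incidences_rpow` — as printed: `I ≥ ¼ n^{4/3}`.

## References

* [Matousek2002] J. Matoušek, *Lectures on Discrete Geometry*, GTM 212, Springer (2002), §4.2,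
  Proposition 4.2.1 and its proof, pp. 51–52 (held text `galaxy-panama-431008558088267`, chunk 77).
-/

namespace Literature.Combinatorics.Extremal.ManyIncidences

open Finset Literature.Combinatorics.Additive

variable (F : Type*) [Field F] [CharZero F] [DecidableEq F]

/-! ### The construction -/

/-- The `k × 4k²` integer grid `P = {(i, j) : i < k, j < 4k²} ⊆ F²` has `4k³` points.
[cite: Matousek2002, §4.2, proof of Proposition 4.2.1 (p. 51)] -/
theorem card_grid (k : ℕ) :
    ((range k ×ˢ range (4 * k ^ 2)).image fun p : ℕ × ℕ => ((p.1 : F), (p.2 : F))).card =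
      4 * k ^ 3 := by
  rw [card_image_of_injective, card_product, card_range, card_range]
  · ring
  · intro p q h
    simp only [Prod.mk.injEq, Nat.cast_inj] at h
    exact Prod.ext h.1 h.2

/-- The lines `L = {y = a x + b : a < 2k, b < 2k²}` are `4k³` distinct lines.
[cite: Matousek2002, §4.2, proof of Proposition 4.2.1 (p. 51)] -/
theorem card_lines (k : ℕ) :
    ((range (2 * k) ×ˢ range (2 * k ^ 2)).image
        fun l : ℕ × ℕ => (Sum.inl ((l.1 : F), (l.2 : F)) : (F × F) ⊕ F)).card = 4 * k ^ 3 := by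
  rw [card_image_of_injective, card_product, card_range, card_range]
  · ring
  · intro p q h
    simp only [Sum.inl.injEq, Prod.mk.injEq, Nat.cast_inj] at h
    exact Prod.ext h.1 h.2

/-- The arithmetic of the construction: for `a < 2k`, `i < k`, `b < 2k²` one has
`a i + b < 2k² + 2k² = 4k²`, so `(i, a i + b)` is a grid point. [cite: Matousek2002, §4.2, proof
of Proposition 4.2.1 ("For `x ∈ [0,k)`, we have `ax + b < ak + b < 2k² + 2k² = 4k²`"), p. 52] -/
theorem mul_add_lt {k a i b : ℕ} (ha : a < 2 * k) (hi : i < k) (hb : b < 2 * k ^ 2) :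
    a * i + b < 4 * k ^ 2 := by
  have h1 : a * i ≤ 2 * k * k := Nat.mul_le_mul ha.le hi.le
  have h2 : 2 * k * k = 2 * k ^ 2 := by ring
  omega

/-- **The incidences of the grid construction.** For the grid `P` (`k × 4k²`) and the lines `L`
(`y = a x + b`, `a < 2k`, `b < 2k²`): every line of `L` passes through a point of `P` above each
abscissa `i < k`, so `I(P, L) ≥ k · |L| = 4k⁴`. [cite: Matousek2002, §4.2, Proposition 4.2.1,
proof, pp. 51–52] -/
theorem grid_incidences (k : ℕ) :
    4 * k ^ 4 ≤
      ((((range k ×ˢ range (4 * k ^ 2)).image fun p : ℕ × ℕ => ((p.1 : F), (p.2 : F))) ×ˢ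
          ((range (2 * k) ×ˢ range (2 * k ^ 2)).image
            fun l : ℕ × ℕ => (Sum.inl ((l.1 : F), (l.2 : F)) : (F × F) ⊕ F))).filter
        fun q => LineIncident q.1 q.2).card := by
  -- the explicit incidences `((i, a i + b), y = a x + b)`
  set g : (ℕ × ℕ) × ℕ → (F × F) × ((F × F) ⊕ F) := fun t =>
    (((t.2 : F), ((t.1.1 * t.2 + t.1.2 : ℕ) : F)), Sum.inl ((t.1.1 : F), (t.1.2 : F))) with hg
  have hinj : Function.Injective g := by
    intro s t h
    simp only [hg, Prod.mk.injEq, Sum.inl.injEq, Nat.cast_inj] at h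
    obtain ⟨⟨hi, -⟩, ha, hb⟩ := h
    exact Prod.ext (Prod.ext ha hb) hi
  have hcard : (((range (2 * k) ×ˢ range (2 * k ^ 2)) ×ˢ range k).image g).card = 4 * k ^ 4 := by
    rw [card_image_of_injective _ hinj, card_product, card_product, card_range, card_range,
      card_range]
    ring
  rw [← hcard]
  refine card_le_card fun q hq => ?_
  rw [mem_image] at hq
  obtain ⟨⟨⟨a, b⟩, i⟩, ht, rfl⟩ := hq
  simp only [mem_product, mem_range] at ht
  obtain ⟨⟨ha, hb⟩, hi⟩ := ht
  rw [mem_filter, mem_product]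
  refine ⟨⟨?_, ?_⟩, ?_⟩
  · -- the point `(i, a i + b)` is in the grid
    rw [mem_image]
    exact ⟨(i, a * i + b), by simp only [mem_product, mem_range]; exact ⟨hi, mul_add_lt ha hi hb⟩,
      rfl⟩
  · -- the line `y = a x + b` is in `L`
    rw [mem_image]
    exact ⟨(a, b), by simp only [mem_product, mem_range]; exact ⟨ha, hb⟩, rfl⟩
  · -- incidence: `a i + b = a · i + b` in `F`
    simp only [hg, LineIncident]
    push_cast
    ring

/-! ### Proposition 4.2.1 -/

/-- **Proposition 4.2.1 (Many point–line incidences).** For every `k` there are a set `P` of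
`n = 4k³` points and a set `L` of `n` lines of the plane `F²` (any field of characteristic `0`)
with at least `k · n = 4k⁴ = 4^{−1/3} n^{4/3}` incidences; hence `I(n,n) = Ω(n^{4/3})`.
[cite: Matousek2002, §4.2, Proposition 4.2.1, pp. 51–52] -/
theorem many_incidences (k : ℕ) :
    ∃ (P : Finset (F × F)) (L : Finset ((F × F) ⊕ F)),
      P.card = 4 * k ^ 3 ∧ L.card = 4 * k ^ 3 ∧
        k * L.card ≤ ((P ×ˢ L).filter fun q => LineIncident q.1 q.2).card := by
  refine ⟨_, _, card_grid F k, card_lines F k, ?_⟩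
  rw [card_lines]
  calc k * (4 * k ^ 3) = 4 * k ^ 4 := by ring
    _ ≤ _ := grid_incidences F k

/-- Proposition 4.2.1 with the exponent made explicit without real powers: there are `n`-point /
`n`-line configurations (`n = 4k³`, any `k`) whose number of incidences `I` satisfies `n⁴ ≤ 4 I³`,
i.e. `I ≥ 4^{−1/3} n^{4/3}`. [cite: Matousek2002, §4.2, Proposition 4.2.1, pp. 51–52] -/
theorem many_incidences_pow (k : ℕ) :
    ∃ (P : Finset (F × F)) (L : Finset ((F × F) ⊕ F)),
      P.card = 4 * k ^ 3 ∧ L.card = 4 * k ^ 3 ∧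
        P.card ^ 4 ≤ 4 * ((P ×ˢ L).filter fun q => LineIncident q.1 q.2).card ^ 3 := by
  obtain ⟨P, L, hP, hL, hI⟩ := many_incidences F k
  refine ⟨P, L, hP, hL, ?_⟩
  rw [hL] at hI
  rw [hP]
  calc (4 * k ^ 3) ^ 4 = 4 * (k * (4 * k ^ 3)) ^ 3 := by ring
    _ ≤ 4 * ((P ×ˢ L).filter fun q => LineIncident q.1 q.2).card ^ 3 := by
        gcongr

/-- **Proposition 4.2.1 as printed**: for `n = 4k³` there are `n` points and `n` lines with
`I(P, L) ≥ ¼ n^{4/3}`. [cite: Matousek2002, §4.2, Proposition 4.2.1 and the last line of its proof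
("`I(P,L) ≥ k·|L| = ¼ n^{4/3}`"), pp. 51–52] -/
theorem many_incidences_rpow (k : ℕ) :
    ∃ (P : Finset (F × F)) (L : Finset ((F × F) ⊕ F)),
      P.card = 4 * k ^ 3 ∧ L.card = 4 * k ^ 3 ∧
        (1 / 4 : ℝ) * (P.card : ℝ) ^ ((4 : ℝ) / 3) ≤
          (((P ×ˢ L).filter fun q => LineIncident q.1 q.2).card : ℝ) := by
  obtain ⟨P, L, hP, hL, hI⟩ := many_incidences F k
  refine ⟨P, L, hP, hL, ?_⟩
  rw [hL] at hI
  rw [hP]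
  -- `I ≥ 4k⁴` as reals
  have hI' : (4 : ℝ) * (k : ℝ) ^ 4 ≤ (((P ×ˢ L).filter fun q => LineIncident q.1 q.2).card : ℝ) := by
    have : 4 * k ^ 4 ≤ ((P ×ˢ L).filter fun q => LineIncident q.1 q.2).card := by
      calc 4 * k ^ 4 = k * (4 * k ^ 3) := by ring
        _ ≤ _ := hI
    exact_mod_cast this
  -- `(4k³)^{4/3} = 4^{4/3} k⁴ ≤ 16 k⁴`
  have hk : (0 : ℝ) ≤ k := Nat.cast_nonneg k
  have h1 : ((4 * k ^ 3 : ℕ) : ℝ) ^ ((4 : ℝ) / 3) = (4 : ℝ) ^ ((4 : ℝ) / 3) * (k : ℝ) ^ 4 := by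
    push_cast
    rw [Real.mul_rpow (by norm_num) (by positivity)]
    congr 1
    rw [show ((k : ℝ) ^ 3) = (k : ℝ) ^ (3 : ℝ) by norm_cast, ← Real.rpow_mul hk,
      show (3 : ℝ) * (4 / 3) = (4 : ℕ) by norm_num, Real.rpow_natCast]
  have h2 : (4 : ℝ) ^ ((4 : ℝ) / 3) ≤ 16 := by
    calc (4 : ℝ) ^ ((4 : ℝ) / 3) ≤ (4 : ℝ) ^ (2 : ℝ) :=
          Real.rpow_le_rpow_of_exponent_le (by norm_num) (by norm_num)
      _ = 16 := by rw [Real.rpow_two]; norm_num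
  rw [h1]
  have h3 : (0 : ℝ) ≤ (k : ℝ) ^ 4 := by positivity
  nlinarith [h2, h3, hI']

end Literature.Combinatorics.Extremal.ManyIncidences
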